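import Mathlib
import Literature.Analysis.Complex.CarlemanTract
import HarnessLib

/-!
# The frequency function of the `∂̄`-inequality `‖∂̄h‖ ≤ M‖h‖` (vector-valued), I: circle functionals

Unique continuation for the first-order elliptic differential inequality `‖∂̄h‖ ≤ M ‖h‖` for maps
`h` of the plane into a complex inner-product space `F` (T. Carleman 1939 for systems in two
variables; this is the analytic atom under unique continuation of `J`-holomorphic curves, McDuff
1991 Lemma 2.3, Wendl 2020 Cor. B.21) by the FREQUENCY FUNCTION (F. Almgren 1979; N. Garofalo,
F.-H. Lin 1986), which for the Cauchy–Riemann operator is a one-page computation needing neither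
Carleman weights nor `L^p` theory nor the Cauchy transform — and works verbatim for vector values,
where the scalar device `∂̄c / c` of `Literature/Analysis/Complex/SimilarityPrinciple.lean` is not
available.

In logarithmic polar coordinates `w = s + iθ` (`z = e^w`, so `g = h ∘ exp` is `2πi`-periodic) put
`D = ∂ₛ`, `A = -i ∂_θ` (symmetric on each circle, `[D, A] = 0`) and note `Dg - Ag = ∂ₛg + i∂_θg`
`= 2 ∂̄_w g` (`= 2 z̄ ∂̄_z h`). With the circle functionals

  `H(s) = ∫₀^{2π} ‖g(s+iθ)‖² dθ`,   `P(s) = Re ∫₀^{2π} ⟪A g, g⟫ dθ`   (`N = P / H` the frequency)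

one has (this file)

* `hasDerivAt_sqNormCircle`: `H' = ∫ 2 Re⟪g, ∂ₛg⟫` (`= 2P + 2 Re⟪g, e⟫`, `e = ∂ₛg + i∂_θg`);
* `hasDerivAt_twistCircle`: `P' = ∫ 2 Re⟪A g, ∂ₛg⟫` (`= 2‖Ag‖² + 2 Re⟪Ag, e⟫`) — one integration
  by parts over the period and the symmetry of second derivatives;
* `frequency_key_nonneg`: for every real `N`,
  `0 ≤ ∫ ‖2Ag - 2N g + e‖² = 4∫‖Ag‖² - 8N P + 4N² H + 4∫Re⟪Ag,e⟫ - 4N ∫Re⟪g,e⟫ + ∫‖e‖²`,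
  which for `N = P/H` reads `P'H - PH' ≥ -(H/2) ∫‖e‖²`, i.e. `N' ≥ -‖e‖²_{L²} / (2H)`;
* `lower_bound_of_frequency`: the resulting ODE lemma — if `‖e‖ ≤ c e^s ‖g‖` pointwise (that is
  `‖∂̄h‖ ≤ (c/2)‖h‖`), then `N + c²e^{2s}/4` is nondecreasing while `H > 0`, `(log H)' ≤ 2κ` with
  `κ = N(s₀) + c²e^{2s₀}/4 + c e^{s₀}`, hence `H(s) ≥ H(s₀) e^{2κ(s - s₀)}` for all `s ≤ s₀`
  (positivity of `H` propagates to every smaller circle by a connectedness argument);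
* `sqNormCircle_lower_bound`: the same bound stated for `g` itself.

In the variable `r = e^s` this is the doubling / polynomial lower bound `H(r) ≥ H(r₀)(r/r₀)^{2κ}`
behind weak unique continuation and the finite order of vanishing for `‖∂̄h‖ ≤ M‖h‖`; that
translation (`g = h ∘ exp`) is carried out in
`Literature/Analysis/Complex/DbarFrequencyUniqueContinuation.lean`.

## References

* T. Carleman, *Sur un problème d'unicité pour les systèmes d'équations aux dérivées partielles à
  deux variables indépendantes*, Ark. Mat. Astr. Fys. 26B (1939). [Carleman1939Unicite]
* N. Garofalo, F.-H. Lin, *Monotonicity properties of variational integrals, `A_p` weights and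
  unique continuation*, Indiana Univ. Math. J. 35 (1986) 245–268 (the frequency function).
  [GarofaloLin1986]
* D. McDuff, J. Differential Geom. 34 (1991), Lemma 2.3; C. Wendl, *Lectures on Contact
  3-Manifolds, Holomorphic Curves and Intersection Theory* (2020), App. B, Cor. B.21.
  [McDuff1991LocalBehaviour] [Wendl2020]
-/

noncomputable section

open scoped ContDiff Topology ComplexConjugate InnerProductSpace
open Complex MeasureTheory intervalIntegral Set Filter

namespace Literature.Analysis.Complex

namespace DbarFrequency

variable {F : Type*} [NormedAddCommGroup F] [InnerProductSpace ℂ F]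

/-! ### Calculus along the lines `s ↦ s + iθ`, `θ ↦ s + iθ` -/

/-- `d/dt Re⟪u, v⟫ = Re⟪u, v'⟫ + Re⟪u', v⟫`. [folklore] -/
theorem hasDerivAt_re_inner {u v : ℝ → F} {u' v' : F} {t : ℝ} (hu : HasDerivAt u u' t)
    (hv : HasDerivAt v v' t) :
    HasDerivAt (fun t => (⟪u t, v t⟫_ℂ).re) ((⟪u t, v'⟫_ℂ).re + (⟪u', v t⟫_ℂ).re) t := by
  have h := hu.inner ℂ hv
  have h2 := Complex.reCLM.hasFDerivAt.comp_hasDerivAt t h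
  simpa [Function.comp_def] using h2

/-- `d/dt ‖γ‖² = 2 Re⟪γ, γ'⟫` (through `‖γ‖² = Re⟪γ, γ⟫`). [folklore] -/
theorem hasDerivAt_norm_sq_re {γ : ℝ → F} {γ' : F} {t : ℝ} (h : HasDerivAt γ γ' t) :
    HasDerivAt (fun t => ‖γ t‖ ^ 2) (2 * (⟪γ t, γ'⟫_ℂ).re) t := by
  have h2 := hasDerivAt_re_inner h h
  have heq : (fun t => ‖γ t‖ ^ 2) = fun t => (⟪γ t, γ t⟫_ℂ).re :=
    funext fun t => (inner_self_eq_norm_sq (𝕜 := ℂ) (γ t)).symm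
  rw [heq]
  refine h2.congr_deriv ?_
  rw [← inner_conj_symm (γ t) γ', Complex.conj_re]
  ring

/-- `∂ₛ [g(s + iθ)] = Dg(s+iθ)(1)`. [folklore] -/
theorem hasDerivAt_comp_ofReal_add {g : ℂ → F} (hg : Differentiable ℝ g) (θ s : ℝ) :
    HasDerivAt (fun s : ℝ => g ((s : ℂ) + θ * I)) (fderiv ℝ g ((s : ℂ) + θ * I) 1) s := by
  have h1 : HasDerivAt (fun s : ℝ => (s : ℂ) + θ * I) 1 s := by
    simpa using (Complex.ofRealCLM.hasDerivAt (x := s)).add_const (θ * I)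
  exact (hg _).hasFDerivAt.comp_hasDerivAt s h1

/-- `∂_θ [g(s + iθ)] = Dg(s+iθ)(i)`. [folklore] -/
theorem hasDerivAt_comp_add_mul_I {g : ℂ → F} (hg : Differentiable ℝ g) (s θ : ℝ) :
    HasDerivAt (fun θ : ℝ => g ((s : ℂ) + θ * I)) (fderiv ℝ g ((s : ℂ) + θ * I) I) θ := by
  have h1 : HasDerivAt (fun θ : ℝ => (s : ℂ) + θ * I) I θ := by
    simpa using ((Complex.ofRealCLM.hasDerivAt (x := θ)).mul_const I).const_add (s : ℂ)
  exact (hg _).hasFDerivAt.comp_hasDerivAt θ h1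

/-- The partial derivative fields `w ↦ Dg(w)(v)` of a `C²` map are `C¹`. [folklore] -/
theorem contDiff_fderiv_apply {g : ℂ → F} (hg : ContDiff ℝ 2 g) (v : ℂ) :
    ContDiff ℝ 1 fun w => fderiv ℝ g w v :=
  (hg.fderiv_right (m := 1) (by norm_num)).clm_apply contDiff_const

/-- Symmetry of second derivatives: `∂ₛ ∂_θ g = ∂_θ ∂ₛ g` for `C²` maps. [folklore] -/
theorem fderiv_fderiv_I_one {g : ℂ → F} (hg : ContDiff ℝ 2 g) (w : ℂ) :
    fderiv ℝ (fun w => fderiv ℝ g w I) w 1 = fderiv ℝ (fun w => fderiv ℝ g w 1) w I := by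
  have hs := (hg.contDiffAt (x := w)).isSymmSndFDerivAt (by simp)
  have hd : DifferentiableAt ℝ (fderiv ℝ g) w :=
    ((hg.fderiv_right (m := 1) (by norm_num)).differentiable one_ne_zero) w
  rw [fderiv_clm_apply hd (differentiableAt_const _), fderiv_clm_apply hd (differentiableAt_const _)]
  simp only [fderiv_fun_const, Pi.zero_apply, ContinuousLinearMap.comp_zero, zero_add,
    ContinuousLinearMap.flip_apply]
  exact (hs I 1).symm

/-- A periodic map has a periodic derivative. [folklore] -/
theorem fderiv_periodic {g : ℂ → F} {c : ℂ} (hper : ∀ w, g (w + c) = g w) (w : ℂ) :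
    fderiv ℝ g (w + c) = fderiv ℝ g w := by
  have h : (fun w => g (w + c)) = g := funext hper
  rw [← fderiv_comp_add_right, h]

/-- Joint continuity of `(s, θ) ↦ G(s + iθ)`. [folklore] -/
theorem continuous_comp_line {X : Type*} [TopologicalSpace X] {G : ℂ → X} (hG : Continuous G) :
    Continuous fun p : ℝ × ℝ => G ((p.1 : ℂ) + p.2 * I) := by
  fun_prop

/-- Integration by parts over a period for `Re⟪·,·⟫`: if `Re⟪u, v⟫` takes the same value at `0`
and `2π`, then `∫₀^{2π} Re⟪u', v⟫ = -∫₀^{2π} Re⟪u, v'⟫`. [folklore] -/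
theorem integral_re_inner_deriv_left {u v u' v' : ℝ → F} (hu : ∀ θ, HasDerivAt u (u' θ) θ)
    (hv : ∀ θ, HasDerivAt v (v' θ) θ) (huc : Continuous u) (hvc : Continuous v)
    (hu'c : Continuous u') (hv'c : Continuous v')
    (hper : (⟪u (2 * Real.pi), v (2 * Real.pi)⟫_ℂ).re = (⟪u 0, v 0⟫_ℂ).re) :
    ∫ θ in (0 : ℝ)..2 * Real.pi, (⟪u' θ, v θ⟫_ℂ).re =
      -∫ θ in (0 : ℝ)..2 * Real.pi, (⟪u θ, v' θ⟫_ℂ).re := by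
  have hderiv : ∀ θ ∈ uIcc (0 : ℝ) (2 * Real.pi),
      HasDerivAt (fun θ => (⟪u θ, v θ⟫_ℂ).re) ((⟪u θ, v' θ⟫_ℂ).re + (⟪u' θ, v θ⟫_ℂ).re) θ :=
    fun θ _ => hasDerivAt_re_inner (hu θ) (hv θ)
  have hi1 : IntervalIntegrable (fun θ => (⟪u θ, v' θ⟫_ℂ).re) volume 0 (2 * Real.pi) :=
    (Complex.continuous_re.comp (huc.inner hv'c)).intervalIntegrable _ _
  have hi2 : IntervalIntegrable (fun θ => (⟪u' θ, v θ⟫_ℂ).re) volume 0 (2 * Real.pi) :=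
    (Complex.continuous_re.comp (hu'c.inner hvc)).intervalIntegrable _ _
  have h := intervalIntegral.integral_eq_sub_of_hasDerivAt hderiv (hi1.add hi2)
  rw [intervalIntegral.integral_add hi1 hi2, hper, sub_self] at h
  linarith

/-- The pointwise algebra behind the frequency inequality:
`‖2a - 2N x + e‖² = 4‖a‖² - 8N Re⟪a,x⟫ + 4N²‖x‖² + 4Re⟪a,e⟫ - 4N Re⟪x,e⟫ + ‖e‖²`. [folklore] -/
theorem norm_sq_two_smul_sub_add (a x e : F) (N : ℝ) :
    ‖(2 : ℂ) • a - ((2 * N : ℝ) : ℂ) • x + e‖ ^ 2 =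
      4 * ‖a‖ ^ 2 - 8 * N * (⟪a, x⟫_ℂ).re + 4 * N ^ 2 * ‖x‖ ^ 2 + 4 * (⟪a, e⟫_ℂ).re
        - 4 * N * (⟪x, e⟫_ℂ).re + ‖e‖ ^ 2 := by
  rw [← inner_self_eq_norm_sq (𝕜 := ℂ), ← inner_self_eq_norm_sq (𝕜 := ℂ) a,
    ← inner_self_eq_norm_sq (𝕜 := ℂ) x, ← inner_self_eq_norm_sq (𝕜 := ℂ) e]
  simp only [inner_add_left, inner_add_right, inner_sub_left, inner_sub_right, inner_smul_left,
    inner_smul_right, Complex.conj_ofReal, map_ofNat]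
  have h1 : (⟪x, a⟫_ℂ).re = (⟪a, x⟫_ℂ).re := inner_re_symm (𝕜 := ℂ) x a
  have h2 : (⟪e, a⟫_ℂ).re = (⟪a, e⟫_ℂ).re := inner_re_symm (𝕜 := ℂ) e a
  have h3 : (⟪e, x⟫_ℂ).re = (⟪x, e⟫_ℂ).re := inner_re_symm (𝕜 := ℂ) e x
  simp only [RCLike.re_to_complex] at *
  simp only [Complex.add_re, Complex.sub_re, Complex.mul_re, Complex.ofReal_re, Complex.ofReal_im,
    Complex.re_ofNat, Complex.im_ofNat, zero_mul, sub_zero, h1, h2, h3]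
  ring

/-! ### The circle functionals `H`, `P` and their derivatives -/

section Functionals

variable {g : ℂ → F} (hg : ContDiff ℝ 2 g)
include hg

/-- **`H' = ∫ 2 Re⟪g, ∂ₛg⟫`** for `H(s) = ∫₀^{2π} ‖g(s+iθ)‖² dθ`, `g ∈ C²`. [folklore] -/
theorem hasDerivAt_sqNormCircle (s : ℝ) :
    HasDerivAt (fun s : ℝ => ∫ θ in (0 : ℝ)..2 * Real.pi, ‖g ((s : ℂ) + θ * I)‖ ^ 2)
      (∫ θ in (0 : ℝ)..2 * Real.pi,
        2 * (⟪g ((s : ℂ) + θ * I), fderiv ℝ g ((s : ℂ) + θ * I) 1⟫_ℂ).re) s := by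
  have hgc : Continuous g := hg.continuous
  have hg1c : Continuous fun w => fderiv ℝ g w 1 := (contDiff_fderiv_apply hg 1).continuous
  have hgd : Differentiable ℝ g := hg.differentiable (by simp)
  refine CarlemanTract.hasDerivAt_intervalIntegral_of_continuous
    (F := fun x t => ‖g ((x : ℂ) + t * I)‖ ^ 2)
    (F' := fun x t => 2 * (⟪g ((x : ℂ) + t * I), fderiv ℝ g ((x : ℂ) + t * I) 1⟫_ℂ).re) ?_ ?_ ?_ s
  · exact ((continuous_comp_line hgc).norm).pow 2
  · exact continuous_const.mul (Complex.continuous_re.comp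
      ((continuous_comp_line hgc).inner (continuous_comp_line hg1c)))
  · intro x t
    exact hasDerivAt_norm_sq_re (hasDerivAt_comp_ofReal_add hgd t x)

/-- **`P' = ∫ 2 Re⟪A g, ∂ₛg⟫`** for `P(s) = ∫₀^{2π} Re⟪A g, g⟫ dθ`, `A g = -i ∂_θ g`, and a
`2πi`-periodic `g ∈ C²`: differentiate under the integral, then move `∂_θ` from `∂ₛ∂_θ g = ∂_θ∂ₛ g`
to the other factor by parts over the period (`A` is symmetric). [folklore] -/
theorem hasDerivAt_twistCircle (hper : ∀ w, g (w + 2 * Real.pi * I) = g w) (s : ℝ) :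
    HasDerivAt
      (fun s : ℝ => ∫ θ in (0 : ℝ)..2 * Real.pi,
        (⟪(-I) • fderiv ℝ g ((s : ℂ) + θ * I) I, g ((s : ℂ) + θ * I)⟫_ℂ).re)
      (∫ θ in (0 : ℝ)..2 * Real.pi,
        2 * (⟪(-I) • fderiv ℝ g ((s : ℂ) + θ * I) I, fderiv ℝ g ((s : ℂ) + θ * I) 1⟫_ℂ).re) s := by
  have hgc : Continuous g := hg.continuous
  have hgd : Differentiable ℝ g := hg.differentiable (by simp)
  have h1 : ContDiff ℝ 1 fun w => fderiv ℝ g w 1 := contDiff_fderiv_apply hg 1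
  have hI : ContDiff ℝ 1 fun w => fderiv ℝ g w I := contDiff_fderiv_apply hg I
  have hg1c : Continuous fun w => fderiv ℝ g w 1 := h1.continuous
  have hgIc : Continuous fun w => fderiv ℝ g w I := hI.continuous
  have hgId : Differentiable ℝ fun w => fderiv ℝ g w I := hI.differentiable one_ne_zero
  have hg1d : Differentiable ℝ fun w => fderiv ℝ g w 1 := h1.differentiable one_ne_zero
  -- the mixed second derivative field `∂ₛ ∂_θ g`
  have hIsc : Continuous fun w => fderiv ℝ (fun w => fderiv ℝ g w I) w 1 :=
    (hI.continuous_fderiv one_ne_zero).clm_apply continuous_const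
  -- Step 1: differentiate under the integral sign
  have hD : HasDerivAt
      (fun s : ℝ => ∫ θ in (0 : ℝ)..2 * Real.pi,
        (⟪(-I) • fderiv ℝ g ((s : ℂ) + θ * I) I, g ((s : ℂ) + θ * I)⟫_ℂ).re)
      (∫ θ in (0 : ℝ)..2 * Real.pi,
        ((⟪(-I) • fderiv ℝ g ((s : ℂ) + θ * I) I, fderiv ℝ g ((s : ℂ) + θ * I) 1⟫_ℂ).re +
          (⟪(-I) • fderiv ℝ (fun w => fderiv ℝ g w I) ((s : ℂ) + θ * I) 1,
            g ((s : ℂ) + θ * I)⟫_ℂ).re)) s := by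
    refine CarlemanTract.hasDerivAt_intervalIntegral_of_continuous
      (F := fun x t => (⟪(-I) • fderiv ℝ g ((x : ℂ) + t * I) I, g ((x : ℂ) + t * I)⟫_ℂ).re)
      (F' := fun x t => (⟪(-I) • fderiv ℝ g ((x : ℂ) + t * I) I, fderiv ℝ g ((x : ℂ) + t * I) 1⟫_ℂ).re
        + (⟪(-I) • fderiv ℝ (fun w => fderiv ℝ g w I) ((x : ℂ) + t * I) 1, g ((x : ℂ) + t * I)⟫_ℂ).re)
      ?_ ?_ ?_ s
    · exact Complex.continuous_re.comp
        (((continuous_comp_line hgIc).const_smul (-I)).inner (continuous_comp_line hgc))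
    · exact (Complex.continuous_re.comp (((continuous_comp_line hgIc).const_smul (-I)).inner
        (continuous_comp_line hg1c))).add (Complex.continuous_re.comp
          (((continuous_comp_line hIsc).const_smul (-I)).inner (continuous_comp_line hgc)))
    · intro x t
      exact hasDerivAt_re_inner ((hasDerivAt_comp_ofReal_add hgId t x).const_smul (-I))
        (hasDerivAt_comp_ofReal_add hgd t x)
  -- Step 2: `∫ Re⟪-i ∂ₛ∂_θ g, g⟫ = ∫ Re⟪-i ∂_θ g, ∂ₛ g⟫` by symmetry of second derivatives and parts
  have hparts : (∫ θ in (0 : ℝ)..2 * Real.pi,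
      (⟪(-I) • fderiv ℝ (fun w => fderiv ℝ g w I) ((s : ℂ) + θ * I) 1, g ((s : ℂ) + θ * I)⟫_ℂ).re) =
      ∫ θ in (0 : ℝ)..2 * Real.pi,
        (⟪(-I) • fderiv ℝ g ((s : ℂ) + θ * I) I, fderiv ℝ g ((s : ℂ) + θ * I) 1⟫_ℂ).re := by
    -- rewrite the mixed derivative as `∂_θ ∂ₛ g`
    have hsymm : ∀ θ : ℝ, fderiv ℝ (fun w => fderiv ℝ g w I) ((s : ℂ) + θ * I) 1 =
        fderiv ℝ (fun w => fderiv ℝ g w 1) ((s : ℂ) + θ * I) I := fun θ => fderiv_fderiv_I_one hg _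
    simp_rw [hsymm]
    -- parts with `u = -i ∂ₛ g`, `v = g`
    have h := integral_re_inner_deriv_left
      (u := fun θ : ℝ => (-I) • fderiv ℝ g ((s : ℂ) + θ * I) 1)
      (v := fun θ : ℝ => g ((s : ℂ) + θ * I))
      (u' := fun θ : ℝ => (-I) • fderiv ℝ (fun w => fderiv ℝ g w 1) ((s : ℂ) + θ * I) I)
      (v' := fun θ : ℝ => fderiv ℝ g ((s : ℂ) + θ * I) I)
      (fun θ => (hasDerivAt_comp_add_mul_I hg1d s θ).const_smul (-I))
      (fun θ => hasDerivAt_comp_add_mul_I hgd s θ)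
      (((continuous_comp_line hg1c).comp (Continuous.prodMk_right s)).const_smul (-I))
      ((continuous_comp_line hgc).comp (Continuous.prodMk_right s))
      ((((h1.continuous_fderiv one_ne_zero).clm_apply continuous_const :
        Continuous fun w => fderiv ℝ (fun w => fderiv ℝ g w 1) w I) |>
          continuous_comp_line |>.comp (Continuous.prodMk_right s)).const_smul (-I))
      ((continuous_comp_line hgIc).comp (Continuous.prodMk_right s)) ?_
    · rw [h, ← intervalIntegral.integral_neg]
      refine intervalIntegral.integral_congr fun θ _ => ?_
      simp only [inner_smul_left, map_neg, Complex.conj_I, neg_neg]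
      rw [← inner_conj_symm (fderiv ℝ g ((s : ℂ) + θ * I) I) (fderiv ℝ g ((s : ℂ) + θ * I) 1)]
      simp only [Complex.mul_re, Complex.I_re, Complex.I_im, Complex.conj_re, Complex.conj_im,
        zero_mul, one_mul, zero_sub]
    · -- periodicity of the boundary term
      have hw : ((s : ℂ) + (2 * Real.pi : ℝ) * I) = ((s : ℂ) + (0 : ℝ) * I) + 2 * Real.pi * I := by
        push_cast; ring
      rw [hw, hper, fderiv_periodic hper]
  -- conclusion
  have hi1 : IntervalIntegrable (fun θ : ℝ =>
      (⟪(-I) • fderiv ℝ g ((s : ℂ) + θ * I) I, fderiv ℝ g ((s : ℂ) + θ * I) 1⟫_ℂ).re)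
      volume 0 (2 * Real.pi) :=
    ((Complex.continuous_re.comp (((continuous_comp_line hgIc).const_smul (-I)).inner
      (continuous_comp_line hg1c))).comp (Continuous.prodMk_right s)).intervalIntegrable _ _
  have hi2 : IntervalIntegrable (fun θ : ℝ =>
      (⟪(-I) • fderiv ℝ (fun w => fderiv ℝ g w I) ((s : ℂ) + θ * I) 1, g ((s : ℂ) + θ * I)⟫_ℂ).re)
      volume 0 (2 * Real.pi) :=
    ((Complex.continuous_re.comp (((continuous_comp_line hIsc).const_smul (-I)).inner
      (continuous_comp_line hgc))).comp (Continuous.prodMk_right s)).intervalIntegrable _ _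
  refine hD.congr_deriv ?_
  rw [intervalIntegral.integral_add hi1 hi2, hparts, ← two_mul, ← intervalIntegral.integral_const_mul]

/-- **The frequency inequality, integrated form.** With `A g = -i∂_θ g`, `e = ∂ₛ g + i ∂_θ g` on the
circle `s + iθ`, for every real `N`:
`0 ≤ ∫‖2Ag - 2Ng + e‖² = 4∫‖Ag‖² - 8N ∫Re⟪Ag,g⟫ + 4N² ∫‖g‖² + 4∫Re⟪Ag,e⟫ - 4N ∫Re⟪g,e⟫ + ∫‖e‖²`.
For `N = P/H` this is `P'H - PH' ≥ -(H/2)‖e‖²_{L²}` (Garofalo–Lin's monotonicity computation for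
the Cauchy–Riemann operator). [folklore] -/
theorem frequency_key_nonneg (s N : ℝ) :
    0 ≤ 4 * (∫ θ in (0 : ℝ)..2 * Real.pi, ‖(-I) • fderiv ℝ g ((s : ℂ) + θ * I) I‖ ^ 2)
      - 8 * N * (∫ θ in (0 : ℝ)..2 * Real.pi,
          (⟪(-I) • fderiv ℝ g ((s : ℂ) + θ * I) I, g ((s : ℂ) + θ * I)⟫_ℂ).re)
      + 4 * N ^ 2 * (∫ θ in (0 : ℝ)..2 * Real.pi, ‖g ((s : ℂ) + θ * I)‖ ^ 2)
      + 4 * (∫ θ in (0 : ℝ)..2 * Real.pi,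
          (⟪(-I) • fderiv ℝ g ((s : ℂ) + θ * I) I,
            fderiv ℝ g ((s : ℂ) + θ * I) 1 + I • fderiv ℝ g ((s : ℂ) + θ * I) I⟫_ℂ).re)
      - 4 * N * (∫ θ in (0 : ℝ)..2 * Real.pi,
          (⟪g ((s : ℂ) + θ * I),
            fderiv ℝ g ((s : ℂ) + θ * I) 1 + I • fderiv ℝ g ((s : ℂ) + θ * I) I⟫_ℂ).re)
      + ∫ θ in (0 : ℝ)..2 * Real.pi,
          ‖fderiv ℝ g ((s : ℂ) + θ * I) 1 + I • fderiv ℝ g ((s : ℂ) + θ * I) I‖ ^ 2 := by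
  have hgc : Continuous g := hg.continuous
  have hg1c : Continuous fun w => fderiv ℝ g w 1 := (contDiff_fderiv_apply hg 1).continuous
  have hgIc : Continuous fun w => fderiv ℝ g w I := (contDiff_fderiv_apply hg I).continuous
  -- the three fields on the circle, as functions of `θ`
  set a : ℝ → F := fun θ => (-I) • fderiv ℝ g ((s : ℂ) + θ * I) I with ha
  set x : ℝ → F := fun θ => g ((s : ℂ) + θ * I) with hx
  set e : ℝ → F := fun θ => fderiv ℝ g ((s : ℂ) + θ * I) 1 + I • fderiv ℝ g ((s : ℂ) + θ * I) I
    with he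
  have hac : Continuous a := ((continuous_comp_line hgIc).comp (Continuous.prodMk_right s)).const_smul _
  have hxc : Continuous x := (continuous_comp_line hgc).comp (Continuous.prodMk_right s)
  have hec : Continuous e := ((continuous_comp_line hg1c).comp (Continuous.prodMk_right s)).add
    (((continuous_comp_line hgIc).comp (Continuous.prodMk_right s)).const_smul _)
  have hii : ∀ {φ : ℝ → ℝ}, Continuous φ → IntervalIntegrable φ volume 0 (2 * Real.pi) :=
    fun hφ => hφ.intervalIntegrable _ _
  -- the six integrands
  have c1 : Continuous fun θ => ‖a θ‖ ^ 2 := hac.norm.pow 2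
  have c2 : Continuous fun θ => (⟪a θ, x θ⟫_ℂ).re := Complex.continuous_re.comp (hac.inner hxc)
  have c3 : Continuous fun θ => ‖x θ‖ ^ 2 := hxc.norm.pow 2
  have c4 : Continuous fun θ => (⟪a θ, e θ⟫_ℂ).re := Complex.continuous_re.comp (hac.inner hec)
  have c5 : Continuous fun θ => (⟪x θ, e θ⟫_ℂ).re := Complex.continuous_re.comp (hxc.inner hec)
  have c6 : Continuous fun θ => ‖e θ‖ ^ 2 := hec.norm.pow 2
  -- `0 ≤ ∫ ‖2a - 2Nx + e‖²`
  have hnn : 0 ≤ ∫ θ in (0 : ℝ)..2 * Real.pi, ‖(2 : ℂ) • a θ - ((2 * N : ℝ) : ℂ) • x θ + e θ‖ ^ 2 :=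
    intervalIntegral.integral_nonneg (by positivity) fun θ _ => by positivity
  -- expand the integrand and split the integral
  have hexp : (∫ θ in (0 : ℝ)..2 * Real.pi, ‖(2 : ℂ) • a θ - ((2 * N : ℝ) : ℂ) • x θ + e θ‖ ^ 2) =
      4 * (∫ θ in (0 : ℝ)..2 * Real.pi, ‖a θ‖ ^ 2)
        - 8 * N * (∫ θ in (0 : ℝ)..2 * Real.pi, (⟪a θ, x θ⟫_ℂ).re)
        + 4 * N ^ 2 * (∫ θ in (0 : ℝ)..2 * Real.pi, ‖x θ‖ ^ 2)
        + 4 * (∫ θ in (0 : ℝ)..2 * Real.pi, (⟪a θ, e θ⟫_ℂ).re)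
        - 4 * N * (∫ θ in (0 : ℝ)..2 * Real.pi, (⟪x θ, e θ⟫_ℂ).re)
        + ∫ θ in (0 : ℝ)..2 * Real.pi, ‖e θ‖ ^ 2 := by
    rw [intervalIntegral.integral_congr (g := fun θ => 4 * ‖a θ‖ ^ 2 - 8 * N * (⟪a θ, x θ⟫_ℂ).re
        + 4 * N ^ 2 * ‖x θ‖ ^ 2 + 4 * (⟪a θ, e θ⟫_ℂ).re - 4 * N * (⟪x θ, e θ⟫_ℂ).re + ‖e θ‖ ^ 2)
        (fun θ _ => norm_sq_two_smul_sub_add (a θ) (x θ) (e θ) N)]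
    rw [intervalIntegral.integral_add ?_ (hii c6), intervalIntegral.integral_sub ?_ ?_,
      intervalIntegral.integral_add ?_ ?_, intervalIntegral.integral_add ?_ ?_,
      intervalIntegral.integral_sub ?_ ?_, intervalIntegral.integral_const_mul,
      intervalIntegral.integral_const_mul, intervalIntegral.integral_const_mul,
      intervalIntegral.integral_const_mul, intervalIntegral.integral_const_mul]
    all_goals first
      | exact ((((hii (c1.const_mul _)).sub (hii (c2.const_mul _))).add (hii (c3.const_mul _))).add
          (hii (c4.const_mul _))).sub (hii (c5.const_mul _))
      | exact (((hii (c1.const_mul _)).sub (hii (c2.const_mul _))).add (hii (c3.const_mul _))).add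
          (hii (c4.const_mul _))
      | exact ((hii (c1.const_mul _)).sub (hii (c2.const_mul _))).add (hii (c3.const_mul _))
      | exact (hii (c1.const_mul _)).sub (hii (c2.const_mul _))
      | exact hii (c1.const_mul _) | exact hii (c2.const_mul _) | exact hii (c3.const_mul _)
      | exact hii (c4.const_mul _) | exact hii (c5.const_mul _)
  rw [hexp] at hnn
  exact hnn

end Functionals

/-! ### Integration: the lower bound `H(s) ≥ H(s₀) e^{2κ(s-s₀)}` -/

section LowerBound

/-- **Integration of the frequency inequality (ODE comparison).** Let `H ≥ 0` and `P` be
differentiable with `P'H - PH' ≥ -(c e^s)² H²/2` wherever `H > 0` and `H' ≤ 2P + 2 c e^s H`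
(`s ≤ s₀`). If `H(s₀) > 0` then `H(s) ≥ H(s₀) e^{2κ(s - s₀)}` for all `s ≤ s₀`, with
`κ = P(s₀)/H(s₀) + c²e^{2s₀}/4 + c e^{s₀}`: the frequency `N = P/H` has
`(N + c²e^{2s}/4)' ≥ 0`, so `(log H)' = H'/H ≤ 2N + 2ce^s ≤ 2κ` on every interval of
positivity ending at `s₀`, and positivity propagates down to `-∞` because the lower bound is
uniform (a supremum argument). [folklore] -/
theorem lower_bound_of_frequency {H P H' P' : ℝ → ℝ} {c s₀ : ℝ} (hc : 0 ≤ c)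
    (hH : ∀ s, HasDerivAt H (H' s) s) (hP : ∀ s, HasDerivAt P (P' s) s)
    (hHnn : ∀ s, 0 ≤ H s)
    (hkey : ∀ s ≤ s₀, 0 < H s →
      -((c * Real.exp s) ^ 2 * (H s) ^ 2 / 2) ≤ P' s * H s - P s * H' s)
    (hH' : ∀ s ≤ s₀, H' s ≤ 2 * P s + 2 * (c * Real.exp s) * H s)
    (hpos : 0 < H s₀) :
    ∀ s ≤ s₀, H s₀ * Real.exp (2 * (P s₀ / H s₀ + c ^ 2 * Real.exp (2 * s₀) / 4 + c * Real.exp s₀) * (s - s₀))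
      ≤ H s := by
  set κ : ℝ := P s₀ / H s₀ + c ^ 2 * Real.exp (2 * s₀) / 4 + c * Real.exp s₀ with hκ
  have hHc : Continuous H := continuous_iff_continuousAt.2 fun s => (hH s).continuousAt
  -- Claim 1: the bound on an interval of positivity
  have claim1 : ∀ t ≤ s₀, (∀ σ ∈ Icc t s₀, 0 < H σ) → H s₀ * Real.exp (2 * κ * (t - s₀)) ≤ H t := by
    intro t ht hposI
    rcases eq_or_lt_of_le ht with rfl | htlt
    · simp
    -- the frequency `N = P/H` and `Ñ = N + c² e^{2σ}/4`
    have hN : ∀ σ ∈ Icc t s₀, HasDerivAt (fun σ => P σ / H σ + c ^ 2 * Real.exp (2 * σ) / 4)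
        ((P' σ * H σ - P σ * H' σ) / (H σ) ^ 2 + c ^ 2 * Real.exp (2 * σ) / 2) σ := by
      intro σ hσ
      have h1 := (hP σ).div (hH σ) (hposI σ hσ).ne'
      have h2 : HasDerivAt (fun σ => c ^ 2 * Real.exp (2 * σ) / 4) (c ^ 2 * Real.exp (2 * σ) / 2) σ := by
        have h0 : HasDerivAt (fun σ : ℝ => 2 * σ) 2 σ := by
          simpa using (hasDerivAt_id σ).const_mul (2 : ℝ)
        have := (Real.hasDerivAt_exp (2 * σ)).comp σ h0
        have h3 := (this.const_mul (c ^ 2)).div_const 4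
        refine h3.congr_deriv ?_
        ring
      exact h1.add h2
    have hmono : MonotoneOn (fun σ => P σ / H σ + c ^ 2 * Real.exp (2 * σ) / 4) (Icc t s₀) := by
      refine monotoneOn_of_hasDerivWithinAt_nonneg (convex_Icc t s₀)
        (fun σ hσ => (hN σ hσ).continuousAt.continuousWithinAt)
        (fun σ hσ => (hN σ (interior_subset hσ)).hasDerivWithinAt) fun σ hσ => ?_
      rw [interior_Icc] at hσ
      have hσ' : σ ∈ Icc t s₀ := Ioo_subset_Icc_self hσ
      have hHσ := hposI σ hσ'
      have hk := hkey σ hσ'.2 hHσ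
      have hdiv : -((c * Real.exp σ) ^ 2 / 2) ≤ (P' σ * H σ - P σ * H' σ) / H σ ^ 2 := by
        rw [le_div_iff₀ (by positivity)]
        nlinarith
      have : (c * Real.exp σ) ^ 2 = c ^ 2 * Real.exp (2 * σ) := by
        rw [mul_pow, ← Real.exp_nat_mul]; ring_nf
      nlinarith
    -- hence `N σ ≤ N₁ := N s₀ + c² e^{2s₀}/4` on the interval
    have hN1 : ∀ σ ∈ Icc t s₀, P σ / H σ ≤ P s₀ / H s₀ + c ^ 2 * Real.exp (2 * s₀) / 4 := by
      intro σ hσ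
      have h := hmono hσ (right_mem_Icc.2 ht) hσ.2
      simp only at h
      have : 0 ≤ c ^ 2 * Real.exp (2 * σ) / 4 := by positivity
      linarith
    -- `L = log H - 2κσ` is antitone
    have hL : ∀ σ ∈ Icc t s₀, HasDerivAt (fun σ => Real.log (H σ) - 2 * κ * σ)
        (H' σ / H σ - 2 * κ) σ := by
      intro σ hσ
      exact ((hH σ).log (hposI σ hσ).ne').sub ((hasDerivAt_id σ).const_mul (2 * κ) |>.congr_deriv (by simp))
    have hanti : AntitoneOn (fun σ => Real.log (H σ) - 2 * κ * σ) (Icc t s₀) := by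
      refine antitoneOn_of_hasDerivWithinAt_nonpos (convex_Icc t s₀)
        (fun σ hσ => (hL σ hσ).continuousAt.continuousWithinAt)
        (fun σ hσ => (hL σ (interior_subset hσ)).hasDerivWithinAt) fun σ hσ => ?_
      rw [interior_Icc] at hσ
      have hσ' : σ ∈ Icc t s₀ := Ioo_subset_Icc_self hσ
      have hHσ := hposI σ hσ'
      have h1 := hH' σ hσ'.2
      have h2 := hN1 σ hσ'
      have h3 : c * Real.exp σ ≤ c * Real.exp s₀ := mul_le_mul_of_nonneg_left (Real.exp_le_exp.2 hσ'.2) hc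
      have h4 : H' σ / H σ ≤ 2 * (P σ / H σ) + 2 * (c * Real.exp σ) := by
        rw [div_le_iff₀ hHσ, add_mul, mul_assoc, div_mul_cancel₀ _ hHσ.ne']
        linarith
      rw [hκ]
      linarith
    have h := hanti (left_mem_Icc.2 ht) (right_mem_Icc.2 ht) ht
    simp only at h
    -- exponentiate
    have hHt := hposI t (left_mem_Icc.2 ht)
    have : Real.log (H s₀) + 2 * κ * (t - s₀) ≤ Real.log (H t) := by linarith
    calc H s₀ * Real.exp (2 * κ * (t - s₀)) = Real.exp (Real.log (H s₀) + 2 * κ * (t - s₀)) := by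
          rw [Real.exp_add, Real.exp_log hpos]
      _ ≤ Real.exp (Real.log (H t)) := Real.exp_le_exp.2 this
      _ = H t := Real.exp_log hHt
  -- Claim 2: positivity on every `[t, s₀]`
  have claim2 : ∀ t ≤ s₀, ∀ σ ∈ Icc t s₀, 0 < H σ := by
    intro t ht
    by_contra hcon
    push Not at hcon
    obtain ⟨σ₀, hσ₀, hHσ₀⟩ := hcon
    set Z : Set ℝ := {σ | σ ∈ Icc t s₀ ∧ H σ = 0} with hZ
    have hZne : Z.Nonempty := ⟨σ₀, hσ₀, le_antisymm hHσ₀ (hHnn σ₀)⟩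
    have hZbdd : BddAbove Z := ⟨s₀, fun σ hσ => hσ.1.2⟩
    have hZclosed : IsClosed Z := by
      have : Z = Icc t s₀ ∩ H ⁻¹' {0} := by ext σ; simp [hZ]
      rw [this]
      exact isClosed_Icc.inter (isClosed_singleton.preimage hHc)
    set z := sSup Z with hz
    have hzZ : z ∈ Z := hZclosed.csSup_mem hZne hZbdd
    have hz0 : H z = 0 := hzZ.2
    have hzs₀ : z < s₀ := lt_of_le_of_ne hzZ.1.2 fun h => by rw [h] at hz0; linarith
    -- positivity on `(z, s₀]`
    have hposI : ∀ σ ∈ Ioc z s₀, 0 < H σ := by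
      intro σ hσ
      rcases (hHnn σ).lt_or_eq with h | h
      · exact h
      · exfalso
        have hσZ : σ ∈ Z := ⟨⟨le_trans hzZ.1.1 hσ.1.le, hσ.2⟩, h.symm⟩
        exact absurd (le_csSup hZbdd hσZ) (not_le.2 hσ.1)
    -- uniform lower bound on `(z, s₀]`
    set m : ℝ := H s₀ * Real.exp (-(2 * |κ| * (s₀ - z))) with hm
    have hmpos : 0 < m := by positivity
    have hbound : ∀ σ ∈ Ioc z s₀, m ≤ H σ := by
      intro σ hσ
      have h1 := claim1 σ hσ.2 fun τ hτ => hposI τ ⟨lt_of_lt_of_le hσ.1 hτ.1, hτ.2⟩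
      refine le_trans ?_ h1
      rw [hm]
      refine mul_le_mul_of_nonneg_left (Real.exp_le_exp.2 ?_) hpos.le
      have hσs : σ - s₀ ≤ 0 := by linarith [hσ.2]
      have hσz : -(s₀ - z) ≤ σ - s₀ := by linarith [hσ.1]
      nlinarith [abs_nonneg κ, neg_abs_le (κ), le_abs_self κ]
    -- continuity at `z` from the right contradicts `H z = 0`
    have htend : Tendsto H (𝓝[>] z) (𝓝 (H z)) := hHc.continuousAt.continuousWithinAt.tendsto
    have hev : ∀ᶠ σ in 𝓝[>] z, m ≤ H σ :=
      eventually_of_mem (Ioc_mem_nhdsGT hzs₀) hbound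
    have := ge_of_tendsto htend hev
    linarith
  intro s hs
  exact claim1 s hs (claim2 s hs)

end LowerBound

/-! ### The lower bound for the circle functional of `g` -/

section GLevel

variable {g : ℂ → F} (hg : ContDiff ℝ 2 g) (hper : ∀ w, g (w + 2 * Real.pi * I) = g w)
include hg hper

/-- **Frequency lower bound in logarithmic coordinates.** Let `g : ℂ → F` be `C²` and
`2πi`-periodic with `‖∂ₛg + i∂_θg‖ ≤ c e^s ‖g‖` pointwise for `s ≤ s₀` (for `g = h ∘ exp` this
is `‖∂̄h‖ ≤ (c/2)‖h‖` on the disc of radius `e^{s₀}`). If `H(s₀) = ∫₀^{2π}‖g(s₀+iθ)‖² dθ > 0`,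
then for some `κ` and all `s ≤ s₀`: `H(s₀) e^{2κ(s-s₀)} ≤ H(s)`. In particular `H(s) > 0` for
all `s ≤ s₀` (positivity of the circle means propagates inwards) — the unique continuation
mechanism of Carleman (1939) for first-order elliptic systems in the plane, here by the frequency
function of Garofalo–Lin. [cite: Carleman1939Unicite, Théorème 1] -/
theorem sqNormCircle_lower_bound {c s₀ : ℝ} (hc : 0 ≤ c)
    (he : ∀ s : ℝ, s ≤ s₀ → ∀ θ : ℝ,
      ‖fderiv ℝ g ((s : ℂ) + θ * I) 1 + I • fderiv ℝ g ((s : ℂ) + θ * I) I‖ ≤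
        c * Real.exp s * ‖g ((s : ℂ) + θ * I)‖)
    (hpos : 0 < ∫ θ in (0 : ℝ)..2 * Real.pi, ‖g ((s₀ : ℂ) + θ * I)‖ ^ 2) :
    ∃ κ : ℝ, ∀ s : ℝ, s ≤ s₀ →
      (∫ θ in (0 : ℝ)..2 * Real.pi, ‖g ((s₀ : ℂ) + θ * I)‖ ^ 2) * Real.exp (2 * κ * (s - s₀)) ≤
        ∫ θ in (0 : ℝ)..2 * Real.pi, ‖g ((s : ℂ) + θ * I)‖ ^ 2 := by
  have hgc : Continuous g := hg.continuous
  have hg1c : Continuous fun w => fderiv ℝ g w 1 := (contDiff_fderiv_apply hg 1).continuous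
  have hgIc : Continuous fun w => fderiv ℝ g w I := (contDiff_fderiv_apply hg I).continuous
  have hii : ∀ {φ : ℝ → ℝ}, Continuous φ → IntervalIntegrable φ volume 0 (2 * Real.pi) :=
    fun hφ => hφ.intervalIntegrable _ _
  -- the functionals and their derivatives
  set H : ℝ → ℝ := fun s => ∫ θ in (0 : ℝ)..2 * Real.pi, ‖g ((s : ℂ) + θ * I)‖ ^ 2 with hH_def
  set P : ℝ → ℝ := fun s => ∫ θ in (0 : ℝ)..2 * Real.pi,
    (⟪(-I) • fderiv ℝ g ((s : ℂ) + θ * I) I, g ((s : ℂ) + θ * I)⟫_ℂ).re with hP_def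
  set H' : ℝ → ℝ := fun s => ∫ θ in (0 : ℝ)..2 * Real.pi,
    2 * (⟪g ((s : ℂ) + θ * I), fderiv ℝ g ((s : ℂ) + θ * I) 1⟫_ℂ).re with hH'_def
  set P' : ℝ → ℝ := fun s => ∫ θ in (0 : ℝ)..2 * Real.pi,
    2 * (⟪(-I) • fderiv ℝ g ((s : ℂ) + θ * I) I, fderiv ℝ g ((s : ℂ) + θ * I) 1⟫_ℂ).re with hP'_def
  have hHd : ∀ s, HasDerivAt H (H' s) s := fun s => hasDerivAt_sqNormCircle hg s
  have hPd : ∀ s, HasDerivAt P (P' s) s := fun s => hasDerivAt_twistCircle hg hper s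
  have hHnn : ∀ s, 0 ≤ H s := fun s =>
    intervalIntegral.integral_nonneg (by positivity) fun θ _ => by positivity
  -- pointwise facts on the circle `s`
  have key : ∀ s : ℝ, s ≤ s₀ →
      H' s ≤ 2 * P s + 2 * (c * Real.exp s) * H s ∧
      (0 < H s → -((c * Real.exp s) ^ 2 * (H s) ^ 2 / 2) ≤ P' s * H s - P s * H' s) := by
    intro s hs
    -- the fields on the circle
    set a : ℝ → F := fun θ => (-I) • fderiv ℝ g ((s : ℂ) + θ * I) I with ha
    set x : ℝ → F := fun θ => g ((s : ℂ) + θ * I) with hx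
    set e : ℝ → F := fun θ => fderiv ℝ g ((s : ℂ) + θ * I) 1 + I • fderiv ℝ g ((s : ℂ) + θ * I) I
      with he_def
    set x1 : ℝ → F := fun θ => fderiv ℝ g ((s : ℂ) + θ * I) 1 with hx1
    have hac : Continuous a :=
      ((continuous_comp_line hgIc).comp (Continuous.prodMk_right s)).const_smul _
    have hxc : Continuous x := (continuous_comp_line hgc).comp (Continuous.prodMk_right s)
    have hx1c : Continuous x1 := (continuous_comp_line hg1c).comp (Continuous.prodMk_right s)
    have hec : Continuous e := hx1c.add
      (((continuous_comp_line hgIc).comp (Continuous.prodMk_right s)).const_smul _)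
    have hsplit : ∀ θ, x1 θ = a θ + e θ := fun θ => by
      simp only [hx1, ha, he_def, neg_smul]; abel
    -- the scalars
    set Ia : ℝ := ∫ θ in (0 : ℝ)..2 * Real.pi, ‖a θ‖ ^ 2 with hIa
    set Iae : ℝ := ∫ θ in (0 : ℝ)..2 * Real.pi, (⟪a θ, e θ⟫_ℂ).re with hIae
    set Ixe : ℝ := ∫ θ in (0 : ℝ)..2 * Real.pi, (⟪x θ, e θ⟫_ℂ).re with hIxe
    set E : ℝ := ∫ θ in (0 : ℝ)..2 * Real.pi, ‖e θ‖ ^ 2 with hE_def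
    have c1 : Continuous fun θ => ‖a θ‖ ^ 2 := hac.norm.pow 2
    have c4 : Continuous fun θ => (⟪a θ, e θ⟫_ℂ).re := Complex.continuous_re.comp (hac.inner hec)
    have c5 : Continuous fun θ => (⟪x θ, e θ⟫_ℂ).re := Complex.continuous_re.comp (hxc.inner hec)
    have c2 : Continuous fun θ => (⟪a θ, x θ⟫_ℂ).re := Complex.continuous_re.comp (hac.inner hxc)
    have c3 : Continuous fun θ => ‖x θ‖ ^ 2 := hxc.norm.pow 2
    -- `H' = 2P + 2 Ixe`
    have hH'v : H' s = 2 * P s + 2 * Ixe := by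
      have hpt : ∀ θ, 2 * (⟪x θ, x1 θ⟫_ℂ).re = 2 * (⟪a θ, x θ⟫_ℂ).re + 2 * (⟪x θ, e θ⟫_ℂ).re := by
        intro θ
        have hsym : (⟪x θ, a θ⟫_ℂ).re = (⟪a θ, x θ⟫_ℂ).re := by
          simpa using inner_re_symm (𝕜 := ℂ) (x θ) (a θ)
        rw [hsplit θ, inner_add_right, Complex.add_re, hsym]
        ring
      show (∫ θ in (0 : ℝ)..2 * Real.pi, 2 * (⟪x θ, x1 θ⟫_ℂ).re) = 2 * P s + 2 * Ixe
      rw [intervalIntegral.integral_congr (fun θ _ => hpt θ),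
        intervalIntegral.integral_add (hii (c2.const_mul _)) (hii (c5.const_mul _)),
        intervalIntegral.integral_const_mul, intervalIntegral.integral_const_mul]
    -- `P' = 2 Ia + 2 Iae`
    have hP'v : P' s = 2 * Ia + 2 * Iae := by
      have hpt : ∀ θ, 2 * (⟪a θ, x1 θ⟫_ℂ).re = 2 * ‖a θ‖ ^ 2 + 2 * (⟪a θ, e θ⟫_ℂ).re := by
        intro θ
        have hself : (⟪a θ, a θ⟫_ℂ).re = ‖a θ‖ ^ 2 := by
          simpa using inner_self_eq_norm_sq (𝕜 := ℂ) (a θ)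
        rw [hsplit θ, inner_add_right, Complex.add_re, hself]
        ring
      show (∫ θ in (0 : ℝ)..2 * Real.pi, 2 * (⟪a θ, x1 θ⟫_ℂ).re) = 2 * Ia + 2 * Iae
      rw [intervalIntegral.integral_congr (fun θ _ => hpt θ),
        intervalIntegral.integral_add (hii (c1.const_mul _)) (hii (c4.const_mul _)),
        intervalIntegral.integral_const_mul, intervalIntegral.integral_const_mul]
    -- `Ixe ≤ c e^s H`, `E ≤ (c e^s)² H`
    have hεnn : 0 ≤ c * Real.exp s := by positivity
    have hIxe_le : Ixe ≤ c * Real.exp s * H s := by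
      have h1 : Ixe ≤ ∫ θ in (0 : ℝ)..2 * Real.pi, c * Real.exp s * ‖x θ‖ ^ 2 := by
        refine intervalIntegral.integral_mono_on (by positivity) (hii c5)
          (hii (c3.const_mul _)) fun θ _ => ?_
        calc (⟪x θ, e θ⟫_ℂ).re ≤ ‖x θ‖ * ‖e θ‖ := by
              simpa using re_inner_le_norm (𝕜 := ℂ) (x θ) (e θ)
          _ ≤ ‖x θ‖ * (c * Real.exp s * ‖x θ‖) := by gcongr; exact he s hs θ
          _ = c * Real.exp s * ‖x θ‖ ^ 2 := by ring
      rwa [intervalIntegral.integral_const_mul] at h1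
    have hE_le : E ≤ (c * Real.exp s) ^ 2 * H s := by
      have h1 : E ≤ ∫ θ in (0 : ℝ)..2 * Real.pi, (c * Real.exp s) ^ 2 * ‖x θ‖ ^ 2 := by
        refine intervalIntegral.integral_mono_on (by positivity) (hii (hec.norm.pow 2))
          (hii (c3.const_mul _)) fun θ _ => ?_
        calc ‖e θ‖ ^ 2 ≤ (c * Real.exp s * ‖x θ‖) ^ 2 := by
              gcongr
              exact he s hs θ
          _ = (c * Real.exp s) ^ 2 * ‖x θ‖ ^ 2 := by ring
      rwa [intervalIntegral.integral_const_mul] at h1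
    refine ⟨by rw [hH'v]; nlinarith [hHnn s], fun hHs => ?_⟩
    -- the frequency inequality with `N = P/H`
    have K := frequency_key_nonneg hg s (P s / H s)
    have hexpand : H s * (4 * Ia - 8 * (P s / H s) * P s + 4 * (P s / H s) ^ 2 * H s + 4 * Iae
        - 4 * (P s / H s) * Ixe + E) =
        4 * Ia * H s - 4 * (P s) ^ 2 + 4 * Iae * H s - 4 * P s * Ixe + E * H s := by
      field_simp
      ring
    have h1 : 0 ≤ H s * (4 * Ia - 8 * (P s / H s) * P s + 4 * (P s / H s) ^ 2 * H s + 4 * Iae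
        - 4 * (P s / H s) * Ixe + E) := mul_nonneg hHs.le K
    rw [hexpand] at h1
    rw [hP'v, hH'v]
    nlinarith [mul_le_mul_of_nonneg_right hE_le hHs.le]
  -- integrate
  refine ⟨P s₀ / H s₀ + c ^ 2 * Real.exp (2 * s₀) / 4 + c * Real.exp s₀, fun s hs => ?_⟩
  have h := lower_bound_of_frequency hc hHd hPd hHnn (fun s hs hHs => (key s hs).2 hHs)
    (fun s hs => (key s hs).1) hpos s hs
  exact h

end GLevel

end DbarFrequency

end Literature.Analysis.Complex

end
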